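import Mathlib
import Literature.NumberTheory.Transcendental.SemialgebraicMapsProofs
import Summits.KontsevichZagierPeriods.KontsevichZagierPeriods.Theorems.SoloInformedEquidimRelations
import HarnessLib
import HarnessLib.Audit

/-!
# SoloInformed — the last-coordinate substitution as a rule-(2) move (Newton–Leibniz elimination, file 3a)

Solo programme `solo-KontsevichZagierPeriods-informed`, session s245 (K-NF, `paper/nl-elimination.md`
§7.2, FILE 3: the geometric side of THEOREM NF).

Both substitutions of the elimination of the Newton–Leibniz move — the **sheets**
`Ψ(x, t) = (x, F(x, t))` of a fibrewise antiderivative and the **shear**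
`Θ(x, s) = (x, h(x) + s·G(x))` of the flattened base — replace the LAST coordinate of a point of
`ℝⁿ⁺¹` by the value of a function `G`.  This file treats that move once, in every dimension:

* `soloInformedLastSubst G z = update z (last n) (G z)` and its derivative
  `soloInformedLastSubstDeriv φ = pi (update proj (last n) φ)` (`soloInformed_hasFDerivWithinAt_lastSubst`);
* the Jacobian determinant `det (soloInformedLastSubstDeriv φ) = φ (e_last)` — the matrix is lower
  triangular with unit diagonal except the last entry (`soloInformed_det_lastSubstDeriv`);
* `ℚ`-semialgebraicity of the map and of the image (Tarski–Seidenberg, tree facts `…_holds`),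
  injectivity from fibrewise strict monotonicity;
* the **image representation** `soloInformedLastSubstRep r G φ … = [Ψ_G '' r.domain, 1]`
  (integrable by the change-of-variables theorem, its volume being `∫ r.integrand`) and the move
  `of r − of (soloInformedLastSubstRep …) ∈ changeOfVariablesRel ⊆ relations₁₂` whenever
  `r.integrand = |φ · e_last|` on the domain (`soloInformed_of_sub_of_lastSubstRep_mem`).

References: M. Kontsevich, D. Zagier, *Periods* (2001), §1.2, rule 2); Bochnak–Coste–Roy,
*Real algebraic geometry* (1998), Prop. 2.2.7; this work (THEOREM NF, `paper/nl-elimination.md`).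
-/

noncomputable section

open scoped BigOperators Topology

namespace Summit.KontsevichZagierPeriods.KontsevichZagierPeriods.Theorems

open Set MeasureTheory Function
open Literature.ModelTheory.ExponentialFields (IsSemialgebraic)
open Literature.NumberTheory.Transcendental Literature.NumberTheory.Transcendental.KZ

variable {n : ℕ}

/-! ### The map and its derivative -/

/-- The **last-coordinate substitution** `Ψ_G(z) = (z₀, …, z_{n-1}, G z)`. [this work] -/
def soloInformedLastSubst (G : (Fin (n + 1) → ℝ) → ℝ) (z : Fin (n + 1) → ℝ) : Fin (n + 1) → ℝ :=
  update z (Fin.last n) (G z)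

/-- The last coordinate of `Ψ_G z` is `G z`. -/
@[simp] theorem soloInformed_lastSubst_apply_last (G : (Fin (n + 1) → ℝ) → ℝ) (z : Fin (n + 1) → ℝ) :
    soloInformedLastSubst G z (Fin.last n) = G z := by
  simp [soloInformedLastSubst]

/-- The first coordinates of `Ψ_G z` are those of `z`. -/
@[simp] theorem soloInformed_lastSubst_apply_castSucc (G : (Fin (n + 1) → ℝ) → ℝ)
    (z : Fin (n + 1) → ℝ) (i : Fin n) : soloInformedLastSubst G z (Fin.castSucc i) = z (Fin.castSucc i) := by
  simp [soloInformedLastSubst]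

/-- `init (Ψ_G z) = init z`. -/
@[simp] theorem soloInformed_init_lastSubst (G : (Fin (n + 1) → ℝ) → ℝ) (z : Fin (n + 1) → ℝ) :
    Fin.init (soloInformedLastSubst G z) = Fin.init z := by
  funext i
  simp [Fin.init]

/-- `Ψ_G z = snoc (init z) (G z)`. -/
theorem soloInformed_lastSubst_eq_snoc (G : (Fin (n + 1) → ℝ) → ℝ) (z : Fin (n + 1) → ℝ) :
    soloInformedLastSubst G z = Fin.snoc (Fin.init z) (G z) := by
  rw [← soloInformed_init_lastSubst G z]
  conv_lhs => rw [← Fin.snoc_init_self (soloInformedLastSubst G z)]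
  rw [soloInformed_lastSubst_apply_last, soloInformed_init_lastSubst]

/-- The derivative of `Ψ_G` at a point where `G` has derivative `φ`: `v ↦ (v₀, …, v_{n-1}, φ v)`.
[this work] -/
def soloInformedLastSubstDeriv (φ : (Fin (n + 1) → ℝ) →L[ℝ] ℝ) :
    (Fin (n + 1) → ℝ) →L[ℝ] (Fin (n + 1) → ℝ) :=
  ContinuousLinearMap.pi (update (fun i => ContinuousLinearMap.proj (R := ℝ) i) (Fin.last n) φ)

/-- The derivative applied to a vector. -/
theorem soloInformed_lastSubstDeriv_apply (φ : (Fin (n + 1) → ℝ) →L[ℝ] ℝ) (v : Fin (n + 1) → ℝ)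
    (i : Fin (n + 1)) :
    soloInformedLastSubstDeriv φ v i = if i = Fin.last n then φ v else v i := by
  simp only [soloInformedLastSubstDeriv, ContinuousLinearMap.pi_apply]
  by_cases h : i = Fin.last n
  · subst h; simp
  · rw [update_of_ne h, if_neg h]; rfl

/-- **Derivative of the last-coordinate substitution.** [this work] -/
theorem soloInformed_hasFDerivWithinAt_lastSubst {G : (Fin (n + 1) → ℝ) → ℝ}
    {φ : (Fin (n + 1) → ℝ) →L[ℝ] ℝ} {s : Set (Fin (n + 1) → ℝ)} {z : Fin (n + 1) → ℝ}
    (hG : HasFDerivWithinAt G φ s z) :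
    HasFDerivWithinAt (soloInformedLastSubst G) (soloInformedLastSubstDeriv φ) s z := by
  show HasFDerivWithinAt (fun (y : Fin (n + 1) → ℝ) (i : Fin (n + 1)) => update y (Fin.last n) (G y) i)
    (ContinuousLinearMap.pi (update (fun i => ContinuousLinearMap.proj (R := ℝ) i) (Fin.last n) φ)) s z
  refine hasFDerivWithinAt_pi.2 fun i => ?_
  by_cases h : i = Fin.last n
  · subst h
    simp only [update_self]
    exact hG
  · simp only [update_of_ne h]
    exact (hasFDerivAt_apply (𝕜 := ℝ) i z).hasFDerivWithinAt

/-! ### The Jacobian determinant -/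

/-- The Jacobian matrix: the identity with its last row replaced by the row of `φ`. -/
def soloInformedLastSubstMatrix (φ : (Fin (n + 1) → ℝ) →L[ℝ] ℝ) :
    Matrix (Fin (n + 1)) (Fin (n + 1)) ℝ :=
  Matrix.of fun i j => if i = Fin.last n then φ (fun k => if j = k then 1 else 0)
    else (if i = j then 1 else 0)

/-- The derivative is the linear map of the Jacobian matrix. -/
theorem soloInformed_lastSubstDeriv_eq_toLin' (φ : (Fin (n + 1) → ℝ) →L[ℝ] ℝ) :
    ((soloInformedLastSubstDeriv φ : (Fin (n + 1) → ℝ) →L[ℝ] (Fin (n + 1) → ℝ)) :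
      (Fin (n + 1) → ℝ) →ₗ[ℝ] (Fin (n + 1) → ℝ)) = Matrix.toLin' (soloInformedLastSubstMatrix φ) := by
  apply LinearMap.ext fun v => ?_
  funext i
  rw [ContinuousLinearMap.coe_coe, soloInformed_lastSubstDeriv_apply, Matrix.toLin'_apply]
  simp only [Matrix.mulVec, dotProduct, soloInformedLastSubstMatrix, Matrix.of_apply]
  by_cases h : i = Fin.last n
  · rw [if_pos h]
    simp only [h, if_true]
    have hφ := LinearMap.pi_apply_eq_sum_univ (φ : (Fin (n + 1) → ℝ) →ₗ[ℝ] ℝ) v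
    simp only [ContinuousLinearMap.coe_coe] at hφ
    rw [hφ]
    refine Finset.sum_congr rfl fun j _ => ?_
    rw [smul_eq_mul, mul_comm]
  · rw [if_neg h]
    simp only [h, if_false]
    rw [Finset.sum_eq_single i (fun j _ hj => by rw [if_neg (Ne.symm hj), zero_mul])
      (fun hi => absurd (Finset.mem_univ i) hi), if_pos rfl, one_mul]

/-- The Jacobian matrix is lower triangular. -/
theorem soloInformed_lastSubstMatrix_blockTriangular (φ : (Fin (n + 1) → ℝ) →L[ℝ] ℝ) :
    (soloInformedLastSubstMatrix φ).BlockTriangular OrderDual.toDual := by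
  intro i j hij
  have hij' : i < j := hij
  have hi : i ≠ Fin.last n := by
    rintro rfl
    exact (not_lt.2 (Fin.le_last j)) hij'
  simp only [soloInformedLastSubstMatrix, Matrix.of_apply, if_neg hi, if_neg hij'.ne]

/-- **The Jacobian determinant** of the last-coordinate substitution is the last partial derivative:
`det Ψ_G' = φ (e_last)`. [this work] -/
theorem soloInformed_det_lastSubstDeriv (φ : (Fin (n + 1) → ℝ) →L[ℝ] ℝ) :
    (soloInformedLastSubstDeriv φ).det = φ (fun k => if Fin.last n = k then 1 else 0) := by
  rw [ContinuousLinearMap.det, soloInformed_lastSubstDeriv_eq_toLin', LinearMap.det_toLin',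
    Matrix.det_of_lowerTriangular _ (soloInformed_lastSubstMatrix_blockTriangular φ),
    Fin.prod_univ_castSucc]
  have h1 : ∀ i : Fin n, soloInformedLastSubstMatrix φ (Fin.castSucc i) (Fin.castSucc i) = 1 := by
    intro i
    simp [soloInformedLastSubstMatrix, (Fin.castSucc_lt_last i).ne]
  have h2 : soloInformedLastSubstMatrix φ (Fin.last n) (Fin.last n) =
      φ (fun k => if Fin.last n = k then 1 else 0) := by
    simp [soloInformedLastSubstMatrix]
  rw [Finset.prod_congr rfl fun i _ => h1 i, Finset.prod_const_one, one_mul, h2]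

/-- The Jacobian determinant via `Pi.single`: `det Ψ_G' = φ (Pi.single (last n) 1)`. [this work] -/
theorem soloInformed_det_lastSubstDeriv' (φ : (Fin (n + 1) → ℝ) →L[ℝ] ℝ) :
    (soloInformedLastSubstDeriv φ).det = φ (Pi.single (Fin.last n) 1) := by
  rw [soloInformed_det_lastSubstDeriv]
  congr 1
  funext k
  by_cases hk : k = Fin.last n
  · subst hk; simp
  · simp [hk, Ne.symm hk]

/-! ### Semialgebraicity, injectivity, image -/

/-- The last-coordinate substitution by a `ℚ`-semialgebraic function is a `ℚ`-semialgebraic map.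
[BCR 1998, §2.2] -/
theorem soloInformed_isSemialgebraicMapOn_lastSubst {s : Set (Fin (n + 1) → ℝ)}
    (hs : IsSemialgebraic ℚ s) {G : (Fin (n + 1) → ℝ) → ℝ} (hG : IsSemialgebraicFunOn ℚ s G) :
    IsSemialgebraicMapOn ℚ s (soloInformedLastSubst G) := by
  refine IsSemialgebraicMapOn.of_forall hs fun j => ?_
  by_cases h : j = Fin.last n
  · subst h
    exact hG.congr fun z _ => (soloInformed_lastSubst_apply_last G z).symm
  · exact (isSemialgebraicFunOn_aeval (R := ℝ) (k := ℚ) hs (MvPolynomial.X j)).congr fun z _ => by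
      simp [soloInformedLastSubst, update_of_ne h]

/-- The image of a `ℚ`-semialgebraic set under the substitution is `ℚ`-semialgebraic
(Tarski–Seidenberg). [BCR 1998, Prop. 2.2.7] -/
theorem soloInformed_isSemialgebraic_image_lastSubst {s : Set (Fin (n + 1) → ℝ)}
    (hs : IsSemialgebraic ℚ s) {G : (Fin (n + 1) → ℝ) → ℝ} (hG : IsSemialgebraicFunOn ℚ s G) :
    IsSemialgebraic ℚ (soloInformedLastSubst G '' s) :=
  IsSemialgebraicMapOn.isSemialgebraic_image_holds (soloInformed_isSemialgebraicMapOn_lastSubst hs hG)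
    Subset.rfl hs

/-- **Injectivity** of the substitution from fibrewise injectivity of `G` (same first coordinates
and same value of `G` ⇒ same point). [this work] -/
theorem soloInformed_injOn_lastSubst {s : Set (Fin (n + 1) → ℝ)} {G : (Fin (n + 1) → ℝ) → ℝ}
    (h : ∀ z ∈ s, ∀ z' ∈ s, Fin.init z = Fin.init z' → G z = G z' → z = z') :
    InjOn (soloInformedLastSubst G) s := by
  intro z hz z' hz' he
  refine h z hz z' hz' ?_ ?_
  · rw [← soloInformed_init_lastSubst G z, he, soloInformed_init_lastSubst]
  · rw [← soloInformed_lastSubst_apply_last G z, he, soloInformed_lastSubst_apply_last]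

/-- **Injectivity from fibrewise strict monotonicity**: if on every fibre `{init z = x} ∩ s` the
function `G` is strictly increasing in the last coordinate then `Ψ_G` is injective on `s`.
[this work] -/
theorem soloInformed_injOn_lastSubst_of_strictMono {s : Set (Fin (n + 1) → ℝ)}
    {G : (Fin (n + 1) → ℝ) → ℝ}
    (h : ∀ z ∈ s, ∀ z' ∈ s, Fin.init z = Fin.init z' → z (Fin.last n) < z' (Fin.last n) → G z < G z') :
    InjOn (soloInformedLastSubst G) s := by
  refine soloInformed_injOn_lastSubst fun z hz z' hz' hi hG => ?_
  rcases lt_trichotomy (z (Fin.last n)) (z' (Fin.last n)) with hlt | heq | hgt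
  · exact absurd hG (h z hz z' hz' hi hlt).ne
  · rw [← Fin.snoc_init_self z, ← Fin.snoc_init_self z', hi, heq]
  · exact absurd hG.symm (h z' hz' z hz hi.symm hgt).ne

/-- The same with `G` strictly decreasing on the fibres. [this work] -/
theorem soloInformed_injOn_lastSubst_of_strictAnti {s : Set (Fin (n + 1) → ℝ)}
    {G : (Fin (n + 1) → ℝ) → ℝ}
    (h : ∀ z ∈ s, ∀ z' ∈ s, Fin.init z = Fin.init z' → z (Fin.last n) < z' (Fin.last n) → G z' < G z) :
    InjOn (soloInformedLastSubst G) s := by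
  refine soloInformed_injOn_lastSubst fun z hz z' hz' hi hG => ?_
  rcases lt_trichotomy (z (Fin.last n)) (z' (Fin.last n)) with hlt | heq | hgt
  · exact absurd hG.symm (h z hz z' hz' hi hlt).ne
  · rw [← Fin.snoc_init_self z, ← Fin.snoc_init_self z', hi, heq]
  · exact absurd hG (h z' hz' z hz hi.symm hgt).ne

/-! ### The image representation and the move -/

/-- **The image representation** `[Ψ_G '' σ, 1]` of the last-coordinate substitution applied to
`r = [σ, |∂_last G|]`: `ℚ`-semialgebraic domain by Tarski–Seidenberg, integrable (finite volume)
by the change-of-variables theorem. [Kontsevich–Zagier 2001, §1.2, rule 2); BCR 1998, Prop. 2.2.7] -/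
def soloInformedLastSubstRep (r : IntegralRep (n + 1)) (G : (Fin (n + 1) → ℝ) → ℝ)
    (φ : (Fin (n + 1) → ℝ) → (Fin (n + 1) → ℝ) →L[ℝ] ℝ) (hG : IsSemialgebraicFunOn ℚ r.domain G)
    (hd : ∀ z ∈ r.domain, HasFDerivWithinAt G (φ z) r.domain z)
    (hinj : InjOn (soloInformedLastSubst G) r.domain)
    (hjac : ∀ z ∈ r.domain, r.integrand z = |φ z (Pi.single (Fin.last n) 1)|) :
    IntegralRep (n + 1) where
  domain := soloInformedLastSubst G '' r.domain
  integrand := fun _ => 1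
  isSemialgebraic_domain := soloInformed_isSemialgebraic_image_lastSubst r.isSemialgebraic_domain hG
  isSemialgebraicFunOn_integrand :=
    (isSemialgebraicFunOn_aeval (R := ℝ) (k := ℚ)
      (soloInformed_isSemialgebraic_image_lastSubst r.isSemialgebraic_domain hG) 1).congr
      fun z _ => by simp
  integrableOn := by
    have hDm : MeasurableSet r.domain := IsSemialgebraic.measurableSet_holds r.isSemialgebraic_domain
    rw [integrableOn_image_iff_integrableOn_abs_det_fderiv_smul volume hDm
      (fun z hz => soloInformed_hasFDerivWithinAt_lastSubst (hd z hz)) hinj]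
    refine r.integrableOn.congr_fun (fun z hz => ?_) hDm
    rw [smul_eq_mul, mul_one, soloInformed_det_lastSubstDeriv', hjac z hz]

/-- The domain of the image representation. -/
@[simp] theorem soloInformed_lastSubstRep_domain (r : IntegralRep (n + 1))
    (G : (Fin (n + 1) → ℝ) → ℝ) (φ : (Fin (n + 1) → ℝ) → (Fin (n + 1) → ℝ) →L[ℝ] ℝ)
    (hG : IsSemialgebraicFunOn ℚ r.domain G) (hd : ∀ z ∈ r.domain, HasFDerivWithinAt G (φ z) r.domain z)
    (hinj : InjOn (soloInformedLastSubst G) r.domain)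
    (hjac : ∀ z ∈ r.domain, r.integrand z = |φ z (Pi.single (Fin.last n) 1)|) :
    (soloInformedLastSubstRep r G φ hG hd hinj hjac).domain = soloInformedLastSubst G '' r.domain :=
  rfl

/-- The integrand of the image representation is `1`. -/
@[simp] theorem soloInformed_lastSubstRep_integrand (r : IntegralRep (n + 1))
    (G : (Fin (n + 1) → ℝ) → ℝ) (φ : (Fin (n + 1) → ℝ) → (Fin (n + 1) → ℝ) →L[ℝ] ℝ)
    (hG : IsSemialgebraicFunOn ℚ r.domain G) (hd : ∀ z ∈ r.domain, HasFDerivWithinAt G (φ z) r.domain z)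
    (hinj : InjOn (soloInformedLastSubst G) r.domain)
    (hjac : ∀ z ∈ r.domain, r.integrand z = |φ z (Pi.single (Fin.last n) 1)|) (w : Fin (n + 1) → ℝ) :
    (soloInformedLastSubstRep r G φ hG hd hinj hjac).integrand w = 1 :=
  rfl

/-- **The last-coordinate substitution is a rule-(2) move**:
`[σ, |∂_last G|] − [Ψ_G '' σ, 1] ∈ changeOfVariablesRel`. [Kontsevich–Zagier 2001, §1.2, rule 2)] -/
theorem soloInformed_of_sub_of_lastSubstRep_mem_changeOfVariablesRel (r : IntegralRep (n + 1))
    (G : (Fin (n + 1) → ℝ) → ℝ) (φ : (Fin (n + 1) → ℝ) → (Fin (n + 1) → ℝ) →L[ℝ] ℝ)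
    (hG : IsSemialgebraicFunOn ℚ r.domain G) (hd : ∀ z ∈ r.domain, HasFDerivWithinAt G (φ z) r.domain z)
    (hinj : InjOn (soloInformedLastSubst G) r.domain)
    (hjac : ∀ z ∈ r.domain, r.integrand z = |φ z (Pi.single (Fin.last n) 1)|) :
    of r - of (soloInformedLastSubstRep r G φ hG hd hinj hjac) ∈ changeOfVariablesRel :=
  ⟨n + 1, r, soloInformedLastSubstRep r G φ hG hd hinj hjac, soloInformedLastSubst G,
    fun z => soloInformedLastSubstDeriv (φ z),
    soloInformed_isSemialgebraicMapOn_lastSubst r.isSemialgebraic_domain hG,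
    fun z hz => soloInformed_hasFDerivWithinAt_lastSubst (hd z hz), hinj, rfl,
    fun z hz => by rw [soloInformed_lastSubstRep_integrand, one_mul, soloInformed_det_lastSubstDeriv',
      hjac z hz], rfl⟩

/-- **The last-coordinate substitution in `relations₁₂`**:
`[σ, |∂_last G|] − [Ψ_G '' σ, 1] ∈ relations₁₂`. [Kontsevich–Zagier 2001, §1.2, rule 2)] -/
theorem soloInformed_of_sub_of_lastSubstRep_mem (r : IntegralRep (n + 1))
    (G : (Fin (n + 1) → ℝ) → ℝ) (φ : (Fin (n + 1) → ℝ) → (Fin (n + 1) → ℝ) →L[ℝ] ℝ)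
    (hG : IsSemialgebraicFunOn ℚ r.domain G) (hd : ∀ z ∈ r.domain, HasFDerivWithinAt G (φ z) r.domain z)
    (hinj : InjOn (soloInformedLastSubst G) r.domain)
    (hjac : ∀ z ∈ r.domain, r.integrand z = |φ z (Pi.single (Fin.last n) 1)|) :
    of r - of (soloInformedLastSubstRep r G φ hG hd hinj hjac) ∈ soloInformedEquidimRelations :=
  soloInformed_changeOfVariablesRel_subset_equidimRelations
    (soloInformed_of_sub_of_lastSubstRep_mem_changeOfVariablesRel r G φ hG hd hinj hjac)

/-- The value of the image representation is the volume of the image, and equals `∫_σ r.integrand`.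
[Kontsevich–Zagier 2001, §1.2, rule 2)] -/
theorem soloInformed_value_lastSubstRep (r : IntegralRep (n + 1))
    (G : (Fin (n + 1) → ℝ) → ℝ) (φ : (Fin (n + 1) → ℝ) → (Fin (n + 1) → ℝ) →L[ℝ] ℝ)
    (hG : IsSemialgebraicFunOn ℚ r.domain G) (hd : ∀ z ∈ r.domain, HasFDerivWithinAt G (φ z) r.domain z)
    (hinj : InjOn (soloInformedLastSubst G) r.domain)
    (hjac : ∀ z ∈ r.domain, r.integrand z = |φ z (Pi.single (Fin.last n) 1)|) :
    (soloInformedLastSubstRep r G φ hG hd hinj hjac).value = r.value := by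
  have h := relations_le_ker_eval_holds (changeOfVariablesRel_subset_relations
    (soloInformed_of_sub_of_lastSubstRep_mem_changeOfVariablesRel r G φ hG hd hinj hjac))
  rw [AddMonoidHom.mem_ker, map_sub, sub_eq_zero, eval_of, eval_of] at h
  exact h.symm

end Summit.KontsevichZagierPeriods.KontsevichZagierPeriods.Theorems
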